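import Summits.CriticalPhenomena.PercolationContinuityZ3.Theorems.PercNearOneGluingNoHeavyLowerTailSahiOneStepThresholdStep
import Summits.CriticalPhenomena.PercolationContinuityZ3.Theorems.PercNearOneGluingNoHeavyLowerTailSahiOneStepLayerMonotone
import HarnessLib

/-!
# One-step scheme, `(2′)` half at uniform density — MONO-B: the drift of a dominated, `H`-generated event is nonpositive

Support file (prover prim-ineq-prove-3 gen 21; `--supports stmt-CriticalPhenomena-4575`; memo
`run/shared/lean/prim/prim-ineq-prove-3/PROOF-2PRIME-UNIFORM.md`, Lemma 7 and tool (T3)).  No definitions, no named facts, no sorries, no `native_decide`.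

Block `insert e F` (`e ∉ F`), slot `H = {ω | t+1 ≤ #(insert e F ∩ ω)}` (so that the sections of `H` at `e` are the threshold slots `t` and `t+1` of `F`,
`section_insert_threshold` / `section_sdiff_threshold`), an increasing event `B` which is
* **`e`-dominated**: `ω ∈ B`, `e ∈ ω`, `j ∈ F ∖ ω` ⟹ `(ω ∖ {e}) ∪ {j} ∈ B` (every coordinate of `F` beats `e`; e.g. `B` right-shifted with `e` leftmost), and
* **`H`-generated**: `ω ∈ B` as soon as every `ω' ⊇ ω` with `ω' ∈ H` lies in `B`.
Then (memo Lemma 7) the two sections of `B` at `e` AGREE below level `t+1` of `F` (`section_sdiff_mem_of_dominated`: if `insert e ω ∈ B` and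
`#(F ∩ ω) ≤ t` then `ω ∖ {e} ∈ B`), hence the ball-conditioned drift
`U_B = (1−μH⁰)(μB¹ − μ(H¹∩B¹)) − (1−μH¹)(μB⁰ − μ(H⁰∩B⁰)) = μ{N_F ≤ t}·μ(B⁰ ∩ {N_F < t}) − μ{N_F < t}·μ(B⁰ ∩ {N_F ≤ t})`
is `≤ 0` by BALL MONOTONICITY (`real_inter_ball_mul_le`, tool (T3): `s ↦ μ(U | N_F < s)` is nondecreasing for an increasing `U`, from the layer
monotonicity `real_inter_layer_mul_le` of gen 18) — `drift_nonpos_of_dominated`, the hypothesis `hUB` of the cross-form step lemma.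
-/

noncomputable section

namespace Summit.CriticalPhenomena.PercolationContinuityZ3.Theorems

namespace SahiOneStep

open MeasureTheory
open Literature.Probability.Percolation (DeterminedBy determinedBy_iff)
open Literature.Probability.LatticeModels (prodBernoulli)
open Literature.Probability.Percolation.DecisionTree (ind)
open SahiE3Sections (determinedBy_section_insert determinedBy_section_sdiff)
open scoped Classical

variable {ι : Type*} [Fintype ι]

/-! ## The combinatorial core: the sections of a dominated `H`-generated event agree on the ball -/

omit [Fintype ι] in
/-- **Memo Lemma 7 (core).**  For an increasing, `e`-dominated, `H`-generated `B` (`H` the threshold slot `t+1` of `insert e F`, `e ∉ F`):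
if `insert e ω ∈ B` and `#(F ∩ ω) ≤ t` then `ω ∖ {e} ∈ B`.  (A witness `z ⊇ ω ∖ {e}` in `H ∖ B` cannot contain `e`; every `j ∈ F ∩ z ∖ ω` could be
traded for `e`, producing an element of `H ∖ B` above `insert e ω ∈ B`; so `F ∩ z ⊆ ω` and `#(F ∩ ω) ≥ t+1`.) [this work] -/
theorem section_sdiff_mem_of_dominated {F : Finset ι} {e : ι} (heF : e ∉ F) {t : ℕ} {B : Set (Set ι)} (hB : IsUpperSet B)
    (hdom : ∀ ω ∈ B, e ∈ ω → ∀ j ∈ F, j ∉ ω → (ω \ {e}) ∪ {j} ∈ B)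
    (hgen : ∀ ω : Set ι, (∀ ω' : Set ι, ω ⊆ ω' → t + 1 ≤ ((insert e F).filter (· ∈ ω')).card → ω' ∈ B) → ω ∈ B)
    {ω : Set ι} (hω : insert e ω ∈ B) (hsmall : (F.filter (· ∈ ω)).card ≤ t) :
    ω \ {e} ∈ B := by
  by_contra hnot
  have hex : ∃ z : Set ι, ω \ {e} ⊆ z ∧ t + 1 ≤ ((insert e F).filter (· ∈ z)).card ∧ z ∉ B := by
    by_contra h
    push Not at h
    exact hnot (hgen _ fun ω' h1 h2 => h ω' h1 h2)
  obtain ⟨z, hsub, hzH, hzB⟩ := hex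
  -- `e ∉ z`, for otherwise `insert e ω ⊆ z ∈ B`
  have hez : e ∉ z := by
    intro hez
    refine hzB (hB ?_ hω)
    intro x hx
    rcases hx with rfl | hx
    · exact hez
    · by_cases hxe : x = e
      · exact hxe ▸ hez
      · exact hsub ⟨hx, hxe⟩
  -- `F ∩ z ⊆ ω`
  have hFz : ∀ j ∈ F, j ∈ z → j ∈ ω := by
    intro j hjF hjz
    by_contra hjω
    have hje : j ≠ e := fun h => heF (h ▸ hjF)
    -- trade `j` for `e`
    have hz'B : (z \ {j}) ∪ {e} ∉ B := by
      intro hz'B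
      have hjz' : j ∉ (z \ {j}) ∪ {e} := by
        rintro (⟨_, hj⟩ | hj)
        · exact hj rfl
        · exact hje hj
      have h := hdom _ hz'B (Or.inr rfl) j hjF hjz'
      have heq : ((z \ {j}) ∪ {e}) \ {e} ∪ {j} = z := by
        ext x
        simp only [Set.mem_union, Set.mem_sdiff, Set.mem_singleton_iff]
        constructor
        · rintro (⟨⟨hx, _⟩ | hx, hxe⟩ | rfl)
          · exact hx
          · exact absurd hx hxe
          · exact hjz
        · intro hx
          by_cases hxj : x = j
          · exact Or.inr hxj
          · exact Or.inl ⟨Or.inl ⟨hx, hxj⟩, fun hxe => hez (hxe ▸ hx)⟩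
      rw [heq] at h
      exact hzB h
    have hz'H : t + 1 ≤ ((insert e F).filter (· ∈ (z \ {j}) ∪ {e})).card := by
      have hfe : (insert e F).filter (· ∈ (z \ {j}) ∪ {e}) = insert e (((insert e F).filter (· ∈ z)).erase j) := by
        ext i
        simp only [Finset.mem_filter, Finset.mem_insert, Finset.mem_erase, Set.mem_union, Set.mem_sdiff,
          Set.mem_singleton_iff]
        constructor
        · rintro ⟨hi, ⟨hiz, hij⟩ | hie⟩
          · exact Or.inr ⟨hij, hi, hiz⟩
          · exact Or.inl hie
        · rintro (hie | ⟨hij, hi, hiz⟩)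
          · exact ⟨Or.inl hie, Or.inr hie⟩
          · exact ⟨hi, Or.inl ⟨hiz, hij⟩⟩
      have hjmem : j ∈ (insert e F).filter (· ∈ z) := Finset.mem_filter.2 ⟨Finset.mem_insert_of_mem hjF, hjz⟩
      have hemem : e ∉ ((insert e F).filter (· ∈ z)).erase j := fun h => hez (Finset.mem_filter.1 (Finset.mem_of_mem_erase h)).2
      rw [hfe, Finset.card_insert_of_notMem hemem, Finset.card_erase_of_mem hjmem]
      have hpos : 0 < ((insert e F).filter (· ∈ z)).card := Finset.card_pos.2 ⟨j, hjmem⟩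
      omega
    have hsub' : insert e ω ⊆ (z \ {j}) ∪ {e} := by
      intro x hx
      rcases hx with rfl | hx
      · exact Or.inr rfl
      · by_cases hxe : x = e
        · exact Or.inr hxe
        · exact Or.inl ⟨hsub ⟨hx, hxe⟩, fun hxj => hjω (hxj ▸ hx)⟩
    exact hz'B (hB hsub' hω)
  -- count: `t+1 ≤ #(insert e F ∩ z) = #(F ∩ z) ≤ #(F ∩ ω) ≤ t`
  have h1 : ((insert e F).filter (· ∈ z)).card = (F.filter (· ∈ z)).card := by
    rw [Finset.filter_insert, if_neg hez]
  have h2 : (F.filter (· ∈ z)).card ≤ (F.filter (· ∈ ω)).card :=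
    Finset.card_le_card fun j hj => by
      rw [Finset.mem_filter] at hj ⊢
      exact ⟨hj.1, hFz j hj.1 hj.2⟩
  omega

omit [Fintype ι] in
/-- Consequently the two sections of `B` at `e` agree on the ball `{N_F < s}` for every `s ≤ t+1`. [this work] -/
theorem section_inter_ball_eq_of_dominated {F : Finset ι} {e : ι} (heF : e ∉ F) {t : ℕ} {B : Set (Set ι)} (hB : IsUpperSet B)
    (hdom : ∀ ω ∈ B, e ∈ ω → ∀ j ∈ F, j ∉ ω → (ω \ {e}) ∪ {j} ∈ B)
    (hgen : ∀ ω : Set ι, (∀ ω' : Set ι, ω ⊆ ω' → t + 1 ≤ ((insert e F).filter (· ∈ ω')).card → ω' ∈ B) → ω ∈ B)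
    {s : ℕ} (hs : s ≤ t + 1) :
    {ω : Set ι | insert e ω ∈ B} ∩ {ω : Set ι | (F.filter (· ∈ ω)).card < s} =
      {ω : Set ι | ω \ {e} ∈ B} ∩ {ω : Set ι | (F.filter (· ∈ ω)).card < s} := by
  ext ω
  simp only [Set.mem_inter_iff, Set.mem_setOf_eq]
  constructor
  · rintro ⟨h1, h2⟩
    exact ⟨section_sdiff_mem_of_dominated heF hB hdom hgen h1 (by omega), h2⟩
  · rintro ⟨h0, h2⟩
    exact ⟨section_sdiff_subset_section_insert hB e h0, h2⟩

/-! ## Ball monotonicity (tool (T3)) -/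

omit [Fintype ι] in
/-- The ball `{N_F < s+1}` is the disjoint union of the ball `{N_F < s}` and the layer `{N_F = s}`. [folklore] -/
theorem ball_succ_eq (F : Finset ι) (s : ℕ) :
    {ω : Set ι | (F.filter (· ∈ ω)).card < s + 1} =
      {ω : Set ι | (F.filter (· ∈ ω)).card < s} ∪ {ω : Set ι | (F.filter (· ∈ ω)).card = s} := by
  ext ω
  simp only [Set.mem_setOf_eq, Set.mem_union]
  omega

omit [Fintype ι] in
/-- The ball and the next layer are disjoint. [folklore] -/
theorem disjoint_ball_layer (F : Finset ι) (s : ℕ) :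
    Disjoint {ω : Set ι | (F.filter (· ∈ ω)).card < s} {ω : Set ι | (F.filter (· ∈ ω)).card = s} :=
  Set.disjoint_left.2 fun ω h1 h2 => by
    simp only [Set.mem_setOf_eq] at h1 h2
    omega

/-- Measure of `X ∩ {N_F < s+1}` = measure of `X ∩ {N_F < s}` + measure of `X ∩ {N_F = s}`. [folklore] -/
theorem real_inter_ball_succ (p : ι → unitInterval) (F : Finset ι) (X : Set (Set ι)) (s : ℕ) :
    (prodBernoulli p).real (X ∩ {ω : Set ι | (F.filter (· ∈ ω)).card < s + 1}) =
      (prodBernoulli p).real (X ∩ {ω : Set ι | (F.filter (· ∈ ω)).card < s}) +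
        (prodBernoulli p).real (X ∩ {ω : Set ι | (F.filter (· ∈ ω)).card = s}) := by
  rw [ball_succ_eq, Set.inter_union_distrib_left]
  exact measureReal_union ((disjoint_ball_layer F s).mono Set.inter_subset_right Set.inter_subset_right)
    MeasurableSet.of_discrete

/-- Measure of `{N_F < s+1}` = measure of `{N_F < s}` + measure of `{N_F = s}`. [folklore] -/
theorem real_ball_succ (p : ι → unitInterval) (F : Finset ι) (s : ℕ) :
    (prodBernoulli p).real {ω : Set ι | (F.filter (· ∈ ω)).card < s + 1} =
      (prodBernoulli p).real {ω : Set ι | (F.filter (· ∈ ω)).card < s} +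
        (prodBernoulli p).real {ω : Set ι | (F.filter (· ∈ ω)).card = s} := by
  have h := real_inter_ball_succ p F Set.univ s
  simp only [Set.univ_inter] at h
  exact h

/-- **Ball vs layer**: for an increasing `F`-determined `U` and `s ≤ k`,  `μ(U ∩ {N_F < s})·μ{N_F = k} ≤ μ(U ∩ {N_F = k})·μ{N_F < s}`
(sum the layer monotonicity `real_inter_layer_mul_le` over the layers `j < s`). [this work] -/
theorem real_inter_ball_mul_layer_le (p : ι → unitInterval) (F : Finset ι) {U : Set (Set ι)} (hU : IsUpperSet U)
    (hUF : DeterminedBy U (↑F : Set ι)) (s k : ℕ) (hsk : s ≤ k) :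
    (prodBernoulli p).real (U ∩ {ω : Set ι | (F.filter (· ∈ ω)).card < s}) *
        (prodBernoulli p).real {ω : Set ι | (F.filter (· ∈ ω)).card = k} ≤
      (prodBernoulli p).real (U ∩ {ω : Set ι | (F.filter (· ∈ ω)).card = k}) *
        (prodBernoulli p).real {ω : Set ι | (F.filter (· ∈ ω)).card < s} := by
  induction s with
  | zero =>
    have h0 : {ω : Set ι | (F.filter (· ∈ ω)).card < 0} = ∅ := by
      ext ω; simp only [Set.mem_setOf_eq, Set.mem_empty_iff_false, iff_false]; omega
    simp only [h0, Set.inter_empty, measureReal_empty, zero_mul, mul_zero, le_refl]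
  | succ s ih =>
    rw [real_inter_ball_succ, real_ball_succ, add_mul, mul_add]
    exact add_le_add (ih (by omega)) (real_inter_layer_mul_le p F hU hUF (by omega))

/-- **BALL MONOTONICITY** (tool (T3)): for an increasing `F`-determined `U`,  `μ(U ∩ {N_F < s})·μ{N_F < s+1} ≤ μ(U ∩ {N_F < s+1})·μ{N_F < s}`,
i.e. `μ(U | N_F < s) ≤ μ(U | N_F ≤ s)`. [this work] -/
theorem real_inter_ball_mul_le (p : ι → unitInterval) (F : Finset ι) {U : Set (Set ι)} (hU : IsUpperSet U)
    (hUF : DeterminedBy U (↑F : Set ι)) (s : ℕ) :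
    (prodBernoulli p).real (U ∩ {ω : Set ι | (F.filter (· ∈ ω)).card < s}) *
        (prodBernoulli p).real {ω : Set ι | (F.filter (· ∈ ω)).card < s + 1} ≤
      (prodBernoulli p).real (U ∩ {ω : Set ι | (F.filter (· ∈ ω)).card < s + 1}) *
        (prodBernoulli p).real {ω : Set ι | (F.filter (· ∈ ω)).card < s} := by
  rw [real_inter_ball_succ, real_ball_succ]
  have h := real_inter_ball_mul_layer_le p F hU hUF s s le_rfl
  nlinarith [h]

/-! ## The drift of a dominated `H`-generated event -/

/-- `1 − μ{s ≤ N_F} = μ{N_F < s}` (probability measure). [folklore] -/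
theorem one_sub_real_threshold (p : ι → unitInterval) (F : Finset ι) (s : ℕ) :
    1 - (prodBernoulli p).real {ω : Set ι | s ≤ (F.filter (· ∈ ω)).card} =
      (prodBernoulli p).real {ω : Set ι | (F.filter (· ∈ ω)).card < s} := by
  have hc : {ω : Set ι | (F.filter (· ∈ ω)).card < s} = {ω : Set ι | s ≤ (F.filter (· ∈ ω)).card}ᶜ := by
    ext ω; simp only [Set.mem_setOf_eq, Set.mem_compl_iff, not_le]
  rw [hc, measureReal_compl MeasurableSet.of_discrete, probReal_univ]

/-- `μX − μ({s ≤ N_F} ∩ X) = μ(X ∩ {N_F < s})`. [folklore] -/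
theorem real_sub_real_threshold_inter (p : ι → unitInterval) (F : Finset ι) (X : Set (Set ι)) (s : ℕ) :
    (prodBernoulli p).real X - (prodBernoulli p).real ({ω : Set ι | s ≤ (F.filter (· ∈ ω)).card} ∩ X) =
      (prodBernoulli p).real (X ∩ {ω : Set ι | (F.filter (· ∈ ω)).card < s}) := by
  have h := measureReal_inter_add_sdiff (μ := prodBernoulli p) (s := X) (t := {ω : Set ι | s ≤ (F.filter (· ∈ ω)).card})
    MeasurableSet.of_discrete
  have hd : X \ {ω : Set ι | s ≤ (F.filter (· ∈ ω)).card} = X ∩ {ω : Set ι | (F.filter (· ∈ ω)).card < s} := by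
    ext ω; simp only [Set.mem_sdiff, Set.mem_setOf_eq, Set.mem_inter_iff, not_le]
  rw [Set.inter_comm] at h
  rw [← hd]
  linarith

/-- **MONO-B** (memo Lemma 7): for the threshold slot `H = {t+1 ≤ #(insert e F ∩ ω)}` (`e ∉ F`) and an increasing, `insert e F`-determined,
`e`-dominated, `H`-generated event `B`, the ball-conditioned drift `U_B` of the cross-form step lemma is `≤ 0`. [this work] -/
theorem drift_nonpos_of_dominated (p : ι → unitInterval) {F : Finset ι} {e : ι} (heF : e ∉ F) (t : ℕ) {B : Set (Set ι)}
    (hB : IsUpperSet B) (hBF : DeterminedBy B (↑(insert e F) : Set ι))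
    (hdom : ∀ ω ∈ B, e ∈ ω → ∀ j ∈ F, j ∉ ω → (ω \ {e}) ∪ {j} ∈ B)
    (hgen : ∀ ω : Set ι, (∀ ω' : Set ι, ω ⊆ ω' → t + 1 ≤ ((insert e F).filter (· ∈ ω')).card → ω' ∈ B) → ω ∈ B) :
    (1 - (prodBernoulli p).real {ω : Set ι | ω \ {e} ∈ {ω : Set ι | t + 1 ≤ ((insert e F).filter (· ∈ ω)).card}}) *
          ((prodBernoulli p).real {ω : Set ι | insert e ω ∈ B} -
            (prodBernoulli p).real ({ω : Set ι | insert e ω ∈ {ω : Set ι | t + 1 ≤ ((insert e F).filter (· ∈ ω)).card}} ∩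
              {ω : Set ι | insert e ω ∈ B}))
        - (1 - (prodBernoulli p).real {ω : Set ι | insert e ω ∈ {ω : Set ι | t + 1 ≤ ((insert e F).filter (· ∈ ω)).card}}) *
          ((prodBernoulli p).real {ω : Set ι | ω \ {e} ∈ B} -
            (prodBernoulli p).real ({ω : Set ι | ω \ {e} ∈ {ω : Set ι | t + 1 ≤ ((insert e F).filter (· ∈ ω)).card}} ∩
              {ω : Set ι | ω \ {e} ∈ B})) ≤ 0 := by
  rw [section_insert_threshold heF, section_sdiff_threshold heF, one_sub_real_threshold, one_sub_real_threshold,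
    real_sub_real_threshold_inter, real_sub_real_threshold_inter]
  -- the sections agree below level `t` (and below `t+1`)
  have hcoe : (↑(insert e F) : Set ι) \ {e} = ↑F := by
    ext i
    simp only [Set.mem_sdiff, Finset.coe_insert, Set.mem_insert_iff, Finset.mem_coe, Set.mem_singleton_iff]
    constructor
    · rintro ⟨h | h, hne⟩
      · exact absurd h hne
      · exact h
    · intro h
      exact ⟨Or.inr h, fun hie => heF (hie ▸ h)⟩
  have hB0F : DeterminedBy {ω : Set ι | ω \ {e} ∈ B} (↑F : Set ι) := hcoe ▸ determinedBy_section_sdiff hBF e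
  have hB0 : IsUpperSet {ω : Set ι | ω \ {e} ∈ B} := isUpperSet_section_sdiff hB e
  rw [section_inter_ball_eq_of_dominated heF hB hdom hgen (Nat.le_succ t)]
  have h := real_inter_ball_mul_le p F hB0 hB0F t
  linarith

end SahiOneStep

end Summit.CriticalPhenomena.PercolationContinuityZ3.Theorems
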